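import Literature.Analysis.Calculus.ConePeriodConePrimitive
import HarnessLib

/-!
# Iterated cone operators and Dupont's cone periods

Sequel of `ConePeriodConePrimitive.lean` (LEMMA F: `conePeriod m (h_b θ) x = conePeriod (m+1) θ (b, x)`).
Iterating, the composite of the cone (Poincaré homotopy) operators `h_{a₀}, h_{a₁}, …` applied to a
form, integrated over a straight simplex, is ONE cone period of the original form over the simplex
with the base points prepended — and in degree `0` (no integration left) the iterated primitive
ITSELF is a cone period:

  `(h_{a_{m-1}} ⋯ h_{a_1} h_{a_0} θ)(y) = ∫_{Δ(a_0, …, a_{m-1}, y)} θ`     (`iterCone_zero_apply`).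

This is the identity that makes the end of the Čech–de Rham / van Est descent staircase of a closed
invariant form EQUAL to Dupont's cone cocycle (`ConePeriodCocycle`, `TwistedQuotient.coneCochain`).
To keep all degree arithmetic definitional the forms are organised in GRADED FAMILIES
`θ : GForm E F = Π r, (E → E [⋀^Fin r]→L[ℝ] F)`, the cone operator acts degreewise
(`hOp b θ r = h_b (θ (r+1))`), and `iterCone m a θ` applies `h_{a 0}` first (innermost), then
`h_{a 1}`, … .  The continuity side condition of LEMMA F is propagated through the iteration by the
hypothesis `hh` (discharged on finite-dimensional spaces by `continuousOn_conePrimitive`).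
Theorems and definitions with bodies; no named fact.
[cite: Dupont1976, §1–2] [cite: Spivak1965, Thm. 4-11]

## References

* J. L. Dupont, *Simplicial de Rham cohomology and characteristic classes of flat bundles*,
  Topology 15 (1976), §1–2. [Dupont1976]
* M. Spivak, *Calculus on Manifolds* (1965), Thm. 4-11. [Spivak1965]
-/

noncomputable section

open Set MeasureTheory Filter Topology

namespace Literature.Analysis.Calculus

variable {E F : Type*} [NormedAddCommGroup E] [NormedSpace ℝ E] [NormedAddCommGroup F] [NormedSpace ℝ F]

/-! ### Graded families and the degreewise cone operator -/

variable (E F) in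
/-- Graded families of forms: one `F`-valued `r`-form on `E` for every degree `r`. [folklore] -/
abbrev GForm : Type _ := ∀ r : ℕ, E → E [⋀^Fin r]→L[ℝ] F

/-- The cone operator with base point `b`, acting degreewise: `(hOp b θ) r = h_b (θ (r+1))`.
[cite: Spivak1965, Thm. 4-11] -/
def hOp (b : E) (θ : GForm E F) : GForm E F := fun r => conePrimitive b (θ (r + 1))

/-- Unfolding. [folklore] -/
@[simp] theorem hOp_apply (b : E) (θ : GForm E F) (r : ℕ) : hOp b θ r = conePrimitive b (θ (r + 1)) := rfl

/-- **Iterated cone operators**: `iterCone m a θ = h_{a (m-1)} (⋯ (h_{a 1} (h_{a 0} θ)))` — the base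
point `a 0` is applied FIRST (innermost). [cite: Dupont1976, §2] -/
def iterCone : (m : ℕ) → (Fin m → E) → GForm E F → GForm E F
  | 0, _, θ => θ
  | m + 1, a, θ => iterCone m (Fin.tail a) (hOp (a 0) θ)

/-- Unfolding. [folklore] -/
@[simp] theorem iterCone_zero (a : Fin 0 → E) (θ : GForm E F) : iterCone 0 a θ = θ := rfl

/-- Unfolding. [folklore] -/
theorem iterCone_succ (m : ℕ) (a : Fin (m + 1) → E) (θ : GForm E F) :
    iterCone (m + 1) a θ = iterCone m (Fin.tail a) (hOp (a 0) θ) := rfl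

/-- The vertices of the simplex computing an iterated cone integral: the base points `a 0, …, a (m-1)`
followed by the given vertices `x 0, …, x k`. [cite: Dupont1976, §2] -/
def consVerts : (m : ℕ) → (Fin m → E) → (k : ℕ) → (Fin (k + 1) → E) → (Fin (k + m + 1) → E)
  | 0, _, _, x => x
  | m + 1, a, k, x => Fin.cons (a 0) (consVerts m (Fin.tail a) k x)

omit [NormedAddCommGroup E] [NormedSpace ℝ E] in
/-- Unfolding. [folklore] -/
@[simp] theorem consVerts_zero (a : Fin 0 → E) (k : ℕ) (x : Fin (k + 1) → E) : consVerts 0 a k x = x := rfl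

omit [NormedAddCommGroup E] [NormedSpace ℝ E] in
/-- Unfolding. [folklore] -/
theorem consVerts_succ (m : ℕ) (a : Fin (m + 1) → E) (k : ℕ) (x : Fin (k + 1) → E) :
    consVerts (m + 1) a k x = Fin.cons (a 0) (consVerts m (Fin.tail a) k x) := rfl

omit [NormedAddCommGroup E] [NormedSpace ℝ E] in
/-- The vertices stay in any set containing the base points and the given vertices. [folklore] -/
theorem consVerts_mem {X : Set E} :
    ∀ (m : ℕ) (a : Fin m → E) (k : ℕ) (x : Fin (k + 1) → E), (∀ i, a i ∈ X) → (∀ i, x i ∈ X) →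
      ∀ i, consVerts m a k x i ∈ X
  | 0, _, _, _, _, hx, i => hx i
  | m + 1, a, k, x, ha, hx, i => by
    rw [consVerts_succ]
    refine Fin.cases ?_ (fun j => ?_) i
    · simpa using ha 0
    · simpa using consVerts_mem m (Fin.tail a) k x (fun j => ha j.succ) hx j

omit [NormedAddCommGroup E] [NormedSpace ℝ E] in
/-- The first vertex is the innermost base point `a 0`. [folklore] -/
@[simp] theorem consVerts_succ_apply_zero (m : ℕ) (a : Fin (m + 1) → E) (k : ℕ) (x : Fin (k + 1) → E) :
    consVerts (m + 1) a k x 0 = a 0 := rfl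

omit [NormedAddCommGroup E] [NormedSpace ℝ E] in
/-- The last vertex is the last given vertex. [folklore] -/
theorem consVerts_apply_last :
    ∀ (m : ℕ) (a : Fin m → E) (k : ℕ) (x : Fin (k + 1) → E),
      consVerts m a k x (Fin.last (k + m)) = x (Fin.last k)
  | 0, _, _, _ => rfl
  | m + 1, a, k, x => by
    rw [consVerts_succ, show (Fin.last (k + (m + 1))) = (Fin.last (k + m)).succ from rfl, Fin.cons_succ]
    exact consVerts_apply_last m (Fin.tail a) k x

/-! ### Iterated cone integrals are cone periods -/

/-- **Iterated cone operators under the cone period.**  On a convex `X` containing the base points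
and the vertices, for a graded family continuous on `X` (and a cone operator preserving continuity
on `X`, hypothesis `hh`):
`conePeriod k ((iterCone m a θ) k) x = conePeriod (k + m) (θ (k + m)) (a 0, …, a (m-1), x 0, …, x k)`.
[cite: Dupont1976, §2] -/
theorem conePeriod_iterCone [CompleteSpace F] {X : Set E} (hXc : Convex ℝ X)
    (hh : ∀ (r : ℕ) (b : E), b ∈ X → ∀ ψ : E → E [⋀^Fin (r + 1)]→L[ℝ] F,
      ContinuousOn ψ X → ContinuousOn (conePrimitive b ψ) X) :
    ∀ (m : ℕ) (a : Fin m → E) (θ : GForm E F), (∀ i, a i ∈ X) → (∀ r, ContinuousOn (θ r) X) →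
      ∀ (k : ℕ) (x : Fin (k + 1) → E), (∀ i, x i ∈ X) →
        conePeriod k (iterCone m a θ k) x = conePeriod (k + m) (θ (k + m)) (consVerts m a k x)
  | 0, _, _, _, _, _, _, _ => rfl
  | m + 1, a, θ, ha, hθ, k, x, hx => by
    have IH := conePeriod_iterCone hXc hh m (Fin.tail a) (hOp (a 0) θ) (fun i => ha i.succ)
      (fun r => hh r (a 0) (ha 0) _ (hθ (r + 1))) k x hx
    calc conePeriod k (iterCone (m + 1) a θ k) x
        = conePeriod (k + m) (hOp (a 0) θ (k + m)) (consVerts m (Fin.tail a) k x) := IH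
      _ = conePeriod (k + m + 1) (θ (k + m + 1)) (Fin.cons (a 0) (consVerts m (Fin.tail a) k x)) :=
          conePeriod_conePrimitive hXc (hθ _) (ha 0)
            (consVerts_mem m (Fin.tail a) k x (fun i => ha i.succ) hx)

/-- **The cone period in degree `0` is evaluation at the vertex.** [folklore] -/
theorem conePeriod_zero_eq [CompleteSpace F] (ψ : E → E [⋀^Fin 0]→L[ℝ] F) (x : Fin 1 → E) (v : Fin 0 → E) :
    conePeriod 0 ψ x = ψ (x 0) v := by
  rw [conePeriod_def]
  have h1 : (fun t : Fin 0 → ℝ => ψ (coneCube 0 x t) (fun j => fderiv ℝ (coneCube 0 x) t (Pi.single j 1)))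
      = fun _ => ψ (x 0) v := by
    funext t
    rw [coneCube_zero, Subsingleton.elim (fun j => fderiv ℝ (coneCube 0 x) t (Pi.single j 1)) v]
  rw [h1, setIntegral_const, measureReal_def]
  have h2 : (volume (Icc (0 : Fin 0 → ℝ) 1)).toReal = 1 := by
    rw [Real.volume_Icc_pi_toReal (by intro i; exact i.elim0)]
    simp
  rw [h2, one_smul]

/-- **The iterated cone primitive of degree `0` is a cone period**:
`(h_{a (m-1)} ⋯ h_{a 0} θ)(y) = ∫_{Δ(a 0, …, a (m-1), y)} θ_m` (degrees written `0 + m`, definitionally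
the statement of `conePeriod_iterCone` at `k = 0`; see `iterCone_zero_apply'` for the cast form).
[cite: Dupont1976, §2] -/
theorem iterCone_zero_apply [CompleteSpace F] {X : Set E} (hXc : Convex ℝ X)
    (hh : ∀ (r : ℕ) (b : E), b ∈ X → ∀ ψ : E → E [⋀^Fin (r + 1)]→L[ℝ] F,
      ContinuousOn ψ X → ContinuousOn (conePrimitive b ψ) X)
    (m : ℕ) (a : Fin m → E) (θ : GForm E F) (ha : ∀ i, a i ∈ X) (hθ : ∀ r, ContinuousOn (θ r) X)
    (y : E) (hy : y ∈ X) (v : Fin 0 → E) :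
    iterCone m a θ 0 y v = conePeriod (0 + m) (θ (0 + m)) (consVerts m a 0 ![y]) := by
  rw [← conePeriod_iterCone hXc hh m a θ ha hθ 0 ![y] (fun i => by fin_cases i; simpa using hy),
    conePeriod_zero_eq _ _ v]
  rfl

/-- Transport of a cone period of a graded family along an equality of degrees. [folklore] -/
theorem conePeriod_gform_congr (θ : GForm E F) {N N' : ℕ} (h : N = N') (x : Fin (N + 1) → E) :
    conePeriod N (θ N) x = conePeriod N' (θ N') (fun i => x (Fin.cast (by rw [h]) i)) := by
  subst h
  rfl

/-- **The iterated cone primitive of degree `0` is a cone period** (cast form, degree `m`):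
`(h_{a (m-1)} ⋯ h_{a 0} θ)(y) = conePeriod m (θ m) (a 0, …, a (m-1), y)`. [cite: Dupont1976, §2] -/
theorem iterCone_zero_apply' [CompleteSpace F] {X : Set E} (hXc : Convex ℝ X)
    (hh : ∀ (r : ℕ) (b : E), b ∈ X → ∀ ψ : E → E [⋀^Fin (r + 1)]→L[ℝ] F,
      ContinuousOn ψ X → ContinuousOn (conePrimitive b ψ) X)
    (m : ℕ) (a : Fin m → E) (θ : GForm E F) (ha : ∀ i, a i ∈ X) (hθ : ∀ r, ContinuousOn (θ r) X)
    (y : E) (hy : y ∈ X) (v : Fin 0 → E) :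
    iterCone m a θ 0 y v =
      conePeriod m (θ m) (fun i => consVerts m a 0 ![y] (Fin.cast (by rw [Nat.zero_add]) i)) := by
  rw [iterCone_zero_apply hXc hh m a θ ha hθ y hy v, conePeriod_gform_congr θ (Nat.zero_add m)]

end Literature.Analysis.Calculus

end
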